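import Summits.BirchSwinnertonDyer.BirchSwinnertonDyer.Theorems.PrintCf2SplitBadEisensteinTwoFrameValue
import Summits.BirchSwinnertonDyer.BirchSwinnertonDyer.Theorems.AdditiveRankOneBSDpRowKernels
import HarnessLib

/-!
# Crux `PrintCf2.SplitBadTwoRankOneOfFacts` (item 20368), line `eisenstein_two_bdp_line` (skeleton d31d09ce), cut D2c of
# `stub_descent_two`, CORE: at `p = 2`, ♭-IMC EQUALITY at one anticyclotomic frame + control (`XAc.HasCharValuationAt … n`) + D2b
# ⟹ the control exponent is `n = 1 + 2·ord₂ log_ω P − 2·ord₂ c` — and what that FORCES on the shape of D2a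

Cell `bsd-print-cf2`, seat `bsd-line-cf2-p1-w2` (prover, width seat on crux stmt-BirchSwinnertonDyer-20368; lead `bsd-line-cf2-p1` g5).
`--supports stmt-BirchSwinnertonDyer-20368` (helper). Theses-free; THEOREMS ONLY (0 definitions, 0 named facts, 0 `sorry`); CONDITIONAL on
`hL : LiuZhangZhang2018.thm151_thm153_modularCurve_heegnerVector_additive` where stated. BSD is proved for no curve by any of this; no summit
statement is proved by this seat.

WHAT THIS IS. The lead's cut of the registered `stub_descent_two` (STATUS 2026-08-28T08:54:44Z): D2a = exact (∅,0) control at `T = 0` WITH the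
`2`-torsion term (research, pen bsd-idea-7), D2b = the LZZ bookkeeping (landed: `PrintCf2SplitBadEisensteinTwoDisplay/FrameValue`), D2c = the
composition. This file is the one-datum CORE of D2c and a kernel-checked CONSTRAINT on D2a:
* §1 `valuation_constantCoeff_eq_of_span_map_eq` (pure `p`-adic algebra, every `p`): `f ∈ Λ = ℤ_p⟦T⟧` with `f(0) ≠ 0`, `Q ∈ 𝓞_{ℂ_p}⟦T⟧` with
  `(f)·𝓞_{ℂ_p}⟦T⟧ = (Q)` and `Q(0) = u·x²`, `‖u‖ = p^{−a}`, `x ∈ ℚ_p` ⟹ `x ≠ 0` and `ord_p f(0) = 2·ord_p x + a` (the EQUALITY form of the two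
  one-sided lemmas `int_two_mul_valuation_le_of_map_mem_span` / `int_valuation_le_two_mul_of_mem_span_map` of the odd-`p` kernel, which
  have `a = 0`).
* §2 **`charExponent_eq_of_flatIMCEq_two`** (`p = 2`, ONE Heegner datum of the class's shape: `4 ∣ N_W`, `K` imaginary quadratic Heegner for `N_W`
  with `d_K < −4`, `P` the non-torsion Heegner point of `Dt`, `rank E(K) = 1`, an anticyclotomic frame `(κ, γ, 𝔭, 𝔭′)`, an embedding datum
  `ι′` inducing `𝔭`, a ♭-frame `Q` with `R1.IsBDPLFunctionInt 2 …`): IF `X_(∅,0)(W/K_∞)` at `𝔭′` has a characteristic power series with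
  `ord₂ f(0) = n` (`XAc.HasCharValuationAt … n` — whatever D2a asserts about `n`) and the ♭-IMC EQUALITY `Ch·𝓞_{ℂ₂}⟦T⟧ = (Q)` holds, THEN
  `n = 1 + 2·ord₂ log_{ω_E} P − 2·ord₂ c` (D2b's `‖u‖₂ = 1/2` read through §1; `log` at `embAt 𝔭′`, moved from `𝔭` by
  `SchneiderFreeAdditiveX3.sq_logOmega_embAt_eq_of_rank_one`). In particular `n` is ODD.
* §3 `kSideIdentity_iff_correction_eq_one` (arithmetic): if a control theorem D2a reads
  `n = ord₂ #Ш(E_K)[2^∞] + 2·(ord₂ log_ω P − ord₂ [E(K):ℤP]) + ord₂ c_K + τ` (the odd-`p` socket `SchneiderFree.AdditiveControlOnTreeAt` is this with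
  `τ = 0` and the split Tamagawa product), then under §2's conclusion the `K`-SIDE `2`-PART of BSD in cell bsd-p2's currency
  (`P2.missingPPartOverAt_baseChange_iff_of_heegner`: `2 + 2·ord₂ I = 2·ord₂ c + 2·ord₂ w_K + ord₂ c_K + ord₂ #Ш(E_K)`, `w_K = 2`) holds IFF `τ = 1`.
  So the line closes EXACTLY when D2a's `2`-torsion correction nets to `+1` on the class — a NUMERIC TARGET for the pen (and a parity test: the
  over-`K` terms are all even — `c_K = c_ℚ²` over a Heegner field, `#Ш` is a square — while the analytic exponent is odd).
The full `stub_descent_two`-shaped assembly (parity → Friedberg–Hoffstein field → Heegner point → frame → §2 → §3 → P2's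
`bsdp_iff_bsdp_twist_of_heegnerIndexOverK` + the twin, which also needs Milne 1972's Weil-restriction identity as a print) is the companion file.

References: [JetchevSkinnerWan2017] Thm. 3.3.1, §7.4.1 (shape of the control exponent); [Castella2018] Thm. 2.3 (torsion / characteristic
ideal); [LiuZhangZhang2018] Thm 1.5.1/1.5.3; [GrossZagier1986] V.(2.2); [Miller2011LMS] Def. 1.1.
-/

set_option autoImplicit false

-- D-0017 layout: summit = sub-problem, so `Summit.BirchSwinnertonDyer.BirchSwinnertonDyer.…` is the mandated namespace of Theorems files.
set_option linter.dupNamespace false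

noncomputable section

open scoped Classical MatrixGroups ModularForm Topology NumberField

namespace Summit.BirchSwinnertonDyer.BirchSwinnertonDyer.Theorems.PrintCf2.EisensteinTwo

open Filter CongruenceSubgroup WeierstrassCurve NumberField IsDedekindDomain Field PowerSeries
  Literature.NumberTheory.EllipticCurves Literature.NumberTheory.EllipticCurves.ModularForms
  Literature.NumberTheory.EllipticCurves.LiuZhangZhang2018 Literature.NumberTheory.EllipticCurves.Rank1Residual
  Literature.NumberTheory.GaloisRepresentations
  Summit.BirchSwinnertonDyer.Rank1Residual Summit.BirchSwinnertonDyer.Rank1Residual.X11b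
  Summit.BirchSwinnertonDyer.Rank1Residual.X11b.AcSelmer Summit.BirchSwinnertonDyer.Rank1Residual.X11b.CongruenceLimit
  Summit.BirchSwinnertonDyer.Rank1Residual.X11b.Halves Summit.BirchSwinnertonDyer.Rank1Residual.X2
  Summit.BirchSwinnertonDyer.BirchSwinnertonDyer.Theorems.UniversalToricDescentWaldspurgerFlat

/-! ### §1 Exponent transfer across a ♭-IMC EQUALITY (every prime) -/

section Algebra

variable {p : ℕ} [Fact p.Prime]

/-- **Exponent transfer across an equality of principal ideals in `𝓞_{ℂ_p}⟦T⟧`.** `f ∈ Λ = ℤ_p⟦T⟧` with `f(0) ≠ 0`, `Q ∈ 𝓞_{ℂ_p}⟦T⟧` with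
`(f)·𝓞_{ℂ_p}⟦T⟧ = (Q)` and `Q(0) = u·x²` with `‖u‖ = p^{−a}` (`x ∈ ℚ_p`) ⟹ `x ≠ 0` and `ord_p f(0) = 2·ord_p x + a`: the constant terms of `f` and `Q`
divide each other in `𝓞_{ℂ_p}`, so `‖f(0)‖ = ‖Q(0)‖ = p^{−a}·‖x‖²`. [folklore] -/
theorem valuation_constantCoeff_eq_of_span_map_eq {f : IwasawaAlgebra p} (hf0 : constantCoeff f ≠ 0)
    {Q : PowerSeries (PadicComplexInt p)} (hfQ : Ideal.span {PowerSeries.map (R1.toCpInt p) f} = Ideal.span {Q})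
    {u : ℂ_[p]} {a : ℕ} (hu : ‖u‖ = ((p : ℝ)⁻¹) ^ a) {x : ℚ_[p]}
    (hQ : IntSeries.HasValueAt Q 0 (u * (algebraMap ℚ_[p] ℂ_[p] x) ^ 2)) :
    x ≠ 0 ∧ ((constantCoeff f).valuation : ℤ) = 2 * x.valuation + a := by
  have hp : p.Prime := Fact.out
  have hp1 : (1 : ℝ) < p := by exact_mod_cast hp.one_lt
  have hp0 : (0 : ℝ) < p := by positivity
  have hQ0 : u * (algebraMap ℚ_[p] ℂ_[p] x) ^ 2 = ((constantCoeff Q : PadicComplexInt p) : ℂ_[p]) :=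
    R1.intSeries_eq_constantCoeff_of_hasValueAt_zero p hQ
  -- `map f ∈ (Q)` and `Q ∈ (map f)`
  have hmem₁ : PowerSeries.map (R1.toCpInt p) f ∈ Ideal.span {Q} := by
    rw [← hfQ]; exact Ideal.mem_span_singleton_self _
  have hmem₂ : Q ∈ Ideal.span {PowerSeries.map (R1.toCpInt p) f} := by
    rw [hfQ]; exact Ideal.mem_span_singleton_self _
  obtain ⟨G, hG⟩ := Ideal.mem_span_singleton'.mp hmem₁
  obtain ⟨G', hG'⟩ := Ideal.mem_span_singleton'.mp hmem₂
  have hfac₁ : algebraMap ℚ_[p] ℂ_[p] ((constantCoeff f : ℤ_[p]) : ℚ_[p]) =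
      ((constantCoeff G : PadicComplexInt p) : ℂ_[p]) * ((constantCoeff Q : PadicComplexInt p) : ℂ_[p]) := by
    rw [← R1.coe_toCpInt, ← constantCoeff_map_apply (R1.toCpInt p) f, ← hG, map_mul, MulMemClass.coe_mul]
  have hfac₂ : ((constantCoeff Q : PadicComplexInt p) : ℂ_[p]) =
      ((constantCoeff G' : PadicComplexInt p) : ℂ_[p]) * algebraMap ℚ_[p] ℂ_[p] ((constantCoeff f : ℤ_[p]) : ℚ_[p]) := by
    rw [← R1.coe_toCpInt, ← constantCoeff_map_apply (R1.toCpInt p) f, ← hG', map_mul, MulMemClass.coe_mul]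
  -- `‖f(0)‖ = ‖u‖·‖x‖²`
  have hle₁ : ‖((constantCoeff f : ℤ_[p]) : ℚ_[p])‖ ≤ ‖u‖ * ‖x‖ ^ 2 := by
    calc ‖((constantCoeff f : ℤ_[p]) : ℚ_[p])‖
        = ‖algebraMap ℚ_[p] ℂ_[p] ((constantCoeff f : ℤ_[p]) : ℚ_[p])‖ := (norm_algebraMap' ℂ_[p] _).symm
      _ = ‖((constantCoeff G : PadicComplexInt p) : ℂ_[p])‖ * ‖((constantCoeff Q : PadicComplexInt p) : ℂ_[p])‖ := by
          rw [hfac₁, norm_mul]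
      _ ≤ 1 * ‖((constantCoeff Q : PadicComplexInt p) : ℂ_[p])‖ :=
          mul_le_mul_of_nonneg_right (R1.norm_coe_padicComplexInt_le_one p _) (norm_nonneg _)
      _ = ‖u‖ * ‖algebraMap ℚ_[p] ℂ_[p] x‖ ^ 2 := by rw [one_mul, ← hQ0, norm_mul, norm_pow]
      _ = ‖u‖ * ‖x‖ ^ 2 := by rw [norm_algebraMap']
  have hle₂ : ‖u‖ * ‖x‖ ^ 2 ≤ ‖((constantCoeff f : ℤ_[p]) : ℚ_[p])‖ := by
    calc ‖u‖ * ‖x‖ ^ 2 = ‖u‖ * ‖algebraMap ℚ_[p] ℂ_[p] x‖ ^ 2 := by rw [norm_algebraMap']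
      _ = ‖((constantCoeff Q : PadicComplexInt p) : ℂ_[p])‖ := by rw [← hQ0, norm_mul, norm_pow]
      _ = ‖((constantCoeff G' : PadicComplexInt p) : ℂ_[p])‖ *
            ‖algebraMap ℚ_[p] ℂ_[p] ((constantCoeff f : ℤ_[p]) : ℚ_[p])‖ := by rw [hfac₂, norm_mul]
      _ ≤ 1 * ‖algebraMap ℚ_[p] ℂ_[p] ((constantCoeff f : ℤ_[p]) : ℚ_[p])‖ :=
          mul_le_mul_of_nonneg_right (R1.norm_coe_padicComplexInt_le_one p _) (norm_nonneg _)
      _ = ‖((constantCoeff f : ℤ_[p]) : ℚ_[p])‖ := by rw [one_mul, norm_algebraMap']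
  have heq : ‖((constantCoeff f : ℤ_[p]) : ℚ_[p])‖ = ‖u‖ * ‖x‖ ^ 2 := le_antisymm hle₁ hle₂
  -- `x ≠ 0`
  have hfn0 : ‖((constantCoeff f : ℤ_[p]) : ℚ_[p])‖ ≠ 0 := by
    rw [← PadicInt.norm_def]; exact norm_ne_zero_iff.mpr hf0
  have hx0 : x ≠ 0 := by
    intro hx
    rw [hx, norm_zero, zero_pow two_ne_zero, mul_zero] at heq
    exact hfn0 heq
  refine ⟨hx0, ?_⟩
  -- norms to valuations
  rw [← PadicInt.norm_def, PadicInt.norm_eq_zpow_neg_valuation hf0, Padic.norm_eq_zpow_neg_valuation hx0, hu] at heq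
  have hrhs : ((p : ℝ)⁻¹) ^ a * (((p : ℝ) ^ (-x.valuation)) ^ 2) = (p : ℝ) ^ (-(2 * x.valuation + a)) := by
    rw [← zpow_natCast ((p : ℝ) ^ (-x.valuation)) 2, ← zpow_mul, ← zpow_neg_one, ← zpow_natCast, ← zpow_mul, ← zpow_add₀ hp0.ne']
    congr 1
    push_cast
    ring
  rw [hrhs] at heq
  have hinj := zpow_right_injective₀ hp0 hp1.ne' heq
  omega

end Algebra

/-! ### §2 The control exponent at `p = 2` from the ♭-IMC equality and D2b -/

section Core

/-- **D2c CORE at `p = 2`: ♭-IMC EQUALITY + control + D2b ⟹ `n = 1 + 2·ord₂ log_ω P − 2·ord₂ c`.** Data: `W/ℚ` globally minimal with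
`4 ∣ N_W`; `K` imaginary quadratic with `d_K < −4` and the Heegner hypothesis for `N_W`; a Heegner datum `(Dt, H, ι_K, P)` with `P` of
infinite order and `rank E(K) = 1` (Kolyvagin, antecedent); `(κ, γ)` anticyclotomic at `2`; two degree-one primes `𝔭, 𝔭′ ∣ 2`; an embedding
datum `ι′` inducing `𝔭`; a ♭-frame `(Ω_K′, Ω_p′, Q)` with `R1.IsBDPLFunctionInt 2 ι′ 𝔭 κ γ Dt.f …`; the algebraic side at `𝔭′`:
`XAc.HasCharValuationAt (W.baseChange K) 2 κ 𝔭′ ∅ γ n` (torsion, `Ch = (f)`, `f(0) ≠ 0`, `ord₂ f(0) = n` — the SHAPE of D2a's conclusion, its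
formula for `n` not used) and the ♭-IMC EQUALITY `Ch·𝓞_{ℂ₂}⟦T⟧ = (Q)` (stubs 2+3 of the line). CONCLUSION:
`n = 1 + 2·padicLogOrd W 2 (embAt 𝔭′) P − 2·ord₂ c`. Proof: D2b (`intSeries_value_of_frame_manin_two`, `‖u‖₂ = 1/2`) at `𝔭`, the square of
the log moved to `𝔭′` (`sq_logOmega_embAt_eq_of_rank_one`), §1 with `a = 1`. CONDITIONAL on `hL`.
[cite: LiuZhangZhang2018, Thm 1.5.1 and Thm 1.5.3 (Duke Math. J. 167 pp. 748–749)] [cite: Castella2018, Thm. 2.3 (arXiv:1704.06608 p. 5) (shape)]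
[cite: JetchevSkinnerWan2017, §7.4.1 (arXiv:1512.06894 p. 30) (shape)] -/
theorem charExponent_eq_of_flatIMCEq_two
    (hL : thm151_thm153_modularCurve_heegnerVector_additive)
    (W : WeierstrassCurve ℚ) [W.IsElliptic] [W.IsGloballyMinimal]
    (K : Type) [Field K] [NumberField K]
    (κ : ZpExtension K 2) (γ : absoluteGaloisGroup K) [Fact (κ.IsTopGenerator γ)] {N : ℕ} [NeZero N]
    (Dt : ModularParametrizationData W N) (H : HeegnerDatum N (NumberField.discr K))
    (ιK : K →+* ℂ) (P : (W.baseChange K).toAffine.Point)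
    (hN : W.conductorNorm ℤ = N) (h4N : 2 ^ 2 ∣ N) (hK : IsImaginaryQuadratic K)
    (hd4 : NumberField.discr K < -4) (hHN : SatisfiesHeegnerHypothesis N K) (hκ : κ.IsAnticyclotomic)
    (hP : WeierstrassCurve.Affine.Point.map ιK.toRatAlgHom P = heegnerPointComplex Dt H)
    (hPinf : ¬ IsOfFinAddOrder P) (hrk : (W.baseChange K).mordellWeilRank = 1)
    (𝔭 : HeightOneSpectrum (𝓞 K)) (h𝔭 : ((2 : ℕ) : 𝓞 K) ∈ 𝔭.asIdeal) (he : 𝔭.asIdeal.ramificationIdx (𝓞 ℚ) = 1)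
    (hf : 𝔭.asIdeal.inertiaDeg (𝓞 ℚ) = 1)
    (𝔭' : HeightOneSpectrum (𝓞 K)) (h𝔭' : ((2 : ℕ) : 𝓞 K) ∈ 𝔭'.asIdeal) (he' : 𝔭'.asIdeal.ramificationIdx (𝓞 ℚ) = 1)
    (hf' : 𝔭'.asIdeal.inertiaDeg (𝓞 ℚ) = 1)
    (ι' : PadicAlgCl 2 ≃+* ℂ) (hind : SchneiderFree.BranchInducesPrime 2 ι' 𝔭)
    {ΩK' : ℂ} {Ωp' : ℂ_[2]} {Q : PowerSeries (PadicComplexInt 2)} (hΩK' : ΩK' ≠ 0) (hΩp' : Ωp' ≠ 0)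
    (hQ : R1.IsBDPLFunctionInt 2 ι' 𝔭 κ γ Dt.f ΩK' Ωp' Q)
    {n : ℕ} (hn : XAc.HasCharValuationAt (W.baseChange K) 2 κ 𝔭' ∅ γ n)
    (hEq : (XAc.charIdeal (W.baseChange K) 2 κ 𝔭' ∅ γ).map (PowerSeries.map (R1.toCpInt 2)) = Ideal.span {Q}) :
    (n : ℤ) = 1 + 2 * X11b.padicLogOrd W 2 (embAt K 2 𝔭' h𝔭' he' hf') P - 2 * (padicValNat 2 Dt.c.natAbs : ℤ) := by
  -- D2b at `𝔭`
  obtain ⟨u, hu, hval⟩ := intSeries_value_of_frame_manin_two hL W K 𝔭 κ γ Dt H ιK P hN h4N hK hd4 h𝔭 he hf hHN hκ hP hPinf ι'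
    hind hΩK' hΩp' hQ
  -- move the square of the log to `𝔭′`
  have hc0 : Dt.c ≠ 0 := Dt.maninConstant_ne_zero_holds
  have hc0' : (Dt.c : ℚ_[2]) ≠ 0 := by exact_mod_cast hc0
  have hlog : logOmega W 2 (embAt K 2 𝔭' h𝔭' he' hf') P ≠ 0 := X11b.R1.logOmega_ne_zero W 2 _ hPinf
  have hsq : (algebraMap ℚ_[2] ℂ_[2] (logOmega W 2 (embAt K 2 𝔭 h𝔭 he hf) P / (Dt.c : ℚ_[2]))) ^ 2 =
      (algebraMap ℚ_[2] ℂ_[2] (logOmega W 2 (embAt K 2 𝔭' h𝔭' he' hf') P / (Dt.c : ℚ_[2]))) ^ 2 := by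
    rw [← map_pow, ← map_pow, div_pow, div_pow,
      SchneiderFreeAdditiveX3.sq_logOmega_embAt_eq_of_rank_one W 2 hK.1 hrk h𝔭 he hf h𝔭' he' hf' P]
  have hval' : IntSeries.HasValueAt Q 0
      (u * (algebraMap ℚ_[2] ℂ_[2] (logOmega W 2 (embAt K 2 𝔭' h𝔭' he' hf') P / (Dt.c : ℚ_[2]))) ^ 2) := by
    rw [← hsq]; exact hval
  -- the algebraic side: `Ch = (f)`, `ord₂ f(0) = n`, and the equality `(f)·𝓞⟦T⟧ = (Q)`
  obtain ⟨-, f, hfI, hf0, hfn⟩ := hn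
  have hspan : Ideal.span {PowerSeries.map (R1.toCpInt 2) f} = Ideal.span {Q} := by
    rw [← map_span_singleton_powerSeries, ← hfI]; exact hEq
  -- §1 with `a = 1`
  have hu' : ‖u‖ = ((2 : ℕ) : ℝ)⁻¹ ^ 1 := by rw [pow_one, hu]; norm_num
  obtain ⟨-, hv⟩ := valuation_constantCoeff_eq_of_span_map_eq (p := 2) hf0 hspan hu' hval'
  rw [hfn, div_eq_mul_inv, Padic.valuation_mul hlog (inv_ne_zero hc0'), Padic.valuation_inv, Padic.valuation_intCast,
    valuation_logOmega hlog] at hv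
  simp only [padicValInt, Nat.cast_one] at hv
  linarith

end Core

/-! ### §3 What the core FORCES on D2a: the `K`-side `2`-part holds iff the correction is `+1` -/

section Reading

/-- **The `K`-side identity iff the `2`-torsion correction is `+1` (arithmetic).** Write D2a's (to-be-typed) control exponent as
`n = s + 2·(ℓ − i) + t + τ` with `s = ord₂ #Ш(E_K)[2^∞]`, `ℓ = ord₂ log_ω P`, `i = ord₂ [E(K):ℤP]`, `t = ord₂ c_K`, `τ` the net `2`-adic
correction (the odd-`p` socket `SchneiderFree.AdditiveControlOnTreeAt` has `τ = 0`). If the core §2 gives `n = 1 + 2ℓ − 2·v` (`v = ord₂ c`), then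
cell bsd-p2's `K`-side `2`-part of BSD — `2 + 2i = 2v + 2·1 + t + s` (`P2.missingPPartOverAt_baseChange_iff_of_heegner` with `ord₂ w_K = 1`) —
holds IFF `τ = 1`. [cite: GrossZagier1986, V.(2.2)] [cite: JetchevSkinnerWan2017, Thm. 3.3.1 (shape)] -/
theorem kSideIdentity_iff_correction_eq_one {n s ℓ i t τ v : ℤ} (hctl : n = s + 2 * (ℓ - i) + t + τ)
    (hcore : n = 1 + 2 * ℓ - 2 * v) :
    (2 + 2 * i = 2 * v + 2 * 1 + t + s) ↔ τ = 1 := by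
  constructor
  · intro h; linarith
  · intro h; linarith

/-- **Corollary (the honest reading for the pen): with the odd-`p` shape `τ = 0` the line CANNOT close at `2`.** If D2a were typed with the
odd-`p` socket's formula (`τ = 0`), the core would force `2 + 2i = 2v + 2 + t + s − 1`, contradicting the `K`-side identity; equivalently
`s + t` would have to be odd, whereas over a Heegner field `t = ord₂ c_K = 2·ord₂ c_ℚ` and `s = ord₂ #Ш(E_K)` are both even. Stated as:
`τ = 0` and the `K`-side identity are incompatible under the core. [cite: JetchevSkinnerWan2017, Thm. 3.3.1 (shape)] -/
theorem not_kSideIdentity_of_correction_eq_zero {n s ℓ i t v : ℤ} (hctl : n = s + 2 * (ℓ - i) + t + 0)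
    (hcore : n = 1 + 2 * ℓ - 2 * v) : ¬ (2 + 2 * i = 2 * v + 2 * 1 + t + s) := by
  intro h
  have := (kSideIdentity_iff_correction_eq_one hctl hcore).mp h
  omega

end Reading

end Summit.BirchSwinnertonDyer.BirchSwinnertonDyer.Theorems.PrintCf2.EisensteinTwo

end
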